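import Literature.NumberTheory.Automorphic.SatakeTransformGL
import Literature.NumberTheory.Automorphic.CartanDecompositionGLnPowers
import Literature.NumberTheory.Automorphic.SatakeParametersGLGelfandPairProofs
import Literature.NumberTheory.Automorphic.SymmLaurentWeylInvariants
import Mathlib.RingTheory.MvPolynomial.Symmetric.FundamentalTheorem
import Mathlib.Data.Fin.Tuple.NatAntidiagonal
import HarnessLib

/-!
# The Satake isomorphism for `GL_n` — discharge of `SatakeParametersGL.satake_gl`

This file proves the named fact `Literature.NumberTheory.Automorphic.SatakeParametersGL.satake_gl`
of `SatakeParametersGL`: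

* `SatakeParametersGL.satake_gl_holds : SatakeParametersGL.satake_gl n F`, i.e.
  `ℋ(GL_n(F), GL_n(𝒪_F)) ≃ₐ[ℂ] ℂ[e_1, …, e_n][e_n⁻¹]` (`heckeAlgebra`, `symmLaurent`) for a
  non-archimedean local field `F` (Satake 1963; Tamagawa 1963; Cartier, *Representations of
  𝔭-adic groups: a survey*, Corvallis 1979, Thm. 4.1 with §IV.2, Example `GL_n`; Shimura (1971),
  Thm. 3.20–3.21; Macdonald (1995), Ch. V, (3.4)–(3.5)).

## The proof

Let `G = GL_n(F)`, `K = GL_n(𝒪)`, `q = #𝓀`, `ϖ` a uniformizer, `T_g` the double-coset operators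
(`HeckeDoubleCosetOperators`), `T_r = T_{diag(ϖ 1_r, 1_{n-r})}`, and `𝒮 : ℋ(G, K) →ₐ[ℂ] ℂ[ℤⁿ]` the
Satake transform of `SatakeTransformGL` (an algebra homomorphism with
`𝒮(T_r) = q^{-r(r-1)/2} e_r(x)`).

1. **The inverse map.** `ℋ(G, K)` is commutative (`SatakeParametersGL.isGelfandPair_glInt_holds`,
   Gelfand's trick), so the fundamental theorem of symmetric polynomials
   (`MvPolynomial.esymmAlgEquiv`) gives `θ₀ : ℂ[e_1, …, e_n] → ℋ(G, K)`, `e_r ↦ q^{r(r-1)/2} T_r`,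
   and since `T_n = T_{ϖ·1}` is a unit (`T_{ϖ·1} T_{ϖ⁻¹·1} = 1`, central twist) it extends to the
   localisation, `θ = SatakeGL.satakeInv : ℂ[e_1, …, e_n][e_n⁻¹] →ₐ[ℂ] ℋ(G, K)`
   (`IsLocalization.Away.liftAlgHom`).
2. **Injectivity.** `𝒮 ∘ θ = ι`, the embedding `ℂ[e][e_n⁻¹] ↪ ℂ[ℤⁿ]` (`e_r ↦ e_r(x)`;
   `symmLaurentToLaurent`, the isomorphism `SymmLaurent.lift` onto `ℂ[ℤⁿ]^{S_n}` of
   `SymmLaurentWeylInvariants` followed by the inclusion, injective), because both are algebra maps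
   agreeing on the `e_r` (`satakeTransform_doubleCosetOperator_heckeDiag`). Hence `θ` is injective
   (Cartier, op. cit., proof of Thm. 4.1: `S` is injective; here read off on the generators).
3. **Surjectivity by a dimension count** (in place of the triangularity argument of Cartier's
   proof, step (c), or Tamagawa's induction, Shimura Thm. 3.20): let
   `A_m = span {T_g : g ∈ Δ_m}` (`Δ_m` = integral `g` with `|det g| = |ϖ|^m`) and
   `P_m = span {monomials of weighted degree m}` in `ℂ[y_1, …, y_n]`, `deg y_{r} = r`.  Then
   `A_a A_b ⊆ A_{a+b}` (support of products, `exists_eq_out_smul_of_coeff_ne_zero`, and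
   `Δ_a Δ_b ⊆ Δ_{a+b}`), so `θ₀(P_m) ⊆ A_m`; `dim A_m ≤ #{a antitone, |a| = m}` by the Cartan
   decomposition with sorted exponents (`exists_glInt_mul_mul_eq_piPowGL_of_mem_glIntDet`,
   `CartanDecompositionGLnPowers`); `#{a antitone, |a| = m} ≤ #{b : ∑ r b_r = m} = dim P_m` via
   `a ↦ (a_r - a_{r+1})_r` (`diffSeq`); and `θ₀` is injective.  So `θ₀(P_m) = A_m`, every `T_g`
   with `g` integral is in the image, `T_{ϖ⁻¹·1}` is in the image (inverse of a unit of the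
   image), and `T_g = T_{ϖ^{-N}·1} T_{ϖ^N g}` in general (central twist); the `T_g` span
   `ℋ(G, K)` (`mem_span_range_doubleCosetOperator`), so `θ` is onto.
4. `satake_gl_holds`: `(AlgEquiv.ofBijective θ).symm` (`SatakeGL.satakeAlgEquiv`).

## References

* P. Cartier, *Representations of 𝔭-adic groups: a survey*, Proc. Sympos. Pure Math. 33 (1979),
  part 1, §IV, Thm. 4.1 and §IV.2 Example [CartierCorvallis1979].
* I. Satake, *Theory of spherical functions on reductive algebraic groups over 𝔭-adic fields*,
  Publ. Math. IHÉS 18 (1963).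
* T. Tamagawa, *On the ζ-functions of a division algebra*, Ann. of Math. 77 (1963)
  [TamagawaAnnals1963].
* G. Shimura, *Introduction to the arithmetic theory of automorphic functions* (1971),
  Thm. 3.20, Thm. 3.21 [ShimuraIATAF1971].
* I. G. Macdonald, *Symmetric functions and Hall polynomials*, 2nd ed. (1995), Ch. V, §3
  [Macdonald1995].
-/

noncomputable section

open scoped Pointwise MatrixGroups
open MulAction ValuativeRel Matrix Finset MonoidAlgebra Representation MvPolynomial
  Literature.LinearAlgebra.Matrix.Echelon

universe u

namespace Literature.NumberTheory.Automorphic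

/-! ### Symmetric polynomials inside the Laurent polynomials `ℂ[ℤⁿ]` -/

section Laurent

variable (n : ℕ)

/-- `toLaurent (e_r) = ∑_{#t = r} x^{𝟙_t}`, the elementary symmetric Laurent polynomial, for the
embedding `SymmLaurent.toLaurent : ℂ[x_1, …, x_n] → ℂ[ℤⁿ]` of `SymmLaurentWeylInvariants`.
[folklore] -/
theorem SymmLaurent.toLaurent_esymm (r : ℕ) :
    SymmLaurent.toLaurent n (esymm (Fin n) ℂ r) = ∑ t ∈ Finset.powersetCard r (univ : Finset (Fin n)),
      AddMonoidAlgebra.single (fun i => if i ∈ t then (1 : ℤ) else 0) (1 : ℂ) := by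
  rw [esymm_eq_sum_monomial, map_sum]
  refine Finset.sum_congr rfl fun t _ => ?_
  rw [SymmLaurent.toLaurent_monomial]
  congr 1
  funext j
  rw [SymmLaurent.expCast_apply, Finsupp.finsetSum_apply]
  simp only [Finsupp.single_apply, Finset.sum_ite_eq', Nat.cast_ite, Nat.cast_one, Nat.cast_zero]

/-- **`ℂ[e_1, …, e_n][e_n⁻¹] → ℂ[ℤⁿ]`**, `e_r ↦ e_r(x)`: the isomorphism
`SymmLaurent.lift : symmLaurent n ≃ ℂ[ℤⁿ]^{S_n}` of `SymmLaurentWeylInvariants` followed by the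
inclusion of the invariants. [folklore] -/
def symmLaurentToLaurent : symmLaurent n →ₐ[ℂ] AddMonoidAlgebra ℂ (Fin n → ℤ) :=
  (weylInvariants ℂ (Fin n → ℤ) (ConnectedReductiveGroupData.glWeylGroup n)).val.comp
    (SymmLaurent.lift n)

/-- `symmLaurentToLaurent` on the image of a symmetric polynomial is `toLaurent`. [folklore] -/
theorem symmLaurentToLaurent_algebraMap (p : MvPolynomial.symmetricSubalgebra (Fin n) ℂ) :
    symmLaurentToLaurent n (algebraMap _ (symmLaurent n) p) =
      SymmLaurent.toLaurent n (p : MvPolynomial (Fin n) ℂ) := by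
  change ((SymmLaurent.lift n (algebraMap _ (symmLaurent n) p) :
      weylInvariants ℂ (Fin n → ℤ) (ConnectedReductiveGroupData.glWeylGroup n)) :
        AddMonoidAlgebra ℂ (Fin n → ℤ)) = _
  rw [SymmLaurent.coe_lift, IsLocalization.Away.lift_eq]
  exact SymmLaurent.coe_toInvariants n p

/-- **`ℂ[e_1, …, e_n][e_n⁻¹] ↪ ℂ[ℤⁿ]` is injective** (`SymmLaurent.lift_injective`). [folklore] -/
theorem symmLaurentToLaurent_injective : Function.Injective (symmLaurentToLaurent n) :=
  Subtype.val_injective.comp (SymmLaurent.lift_injective n)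

/-- The symmetric polynomials embed in their localisation `symmLaurent n`. [folklore] -/
theorem algebraMap_symmLaurent_injective :
    Function.Injective (algebraMap (MvPolynomial.symmetricSubalgebra (Fin n) ℂ) (symmLaurent n)) := by
  have h : Function.Injective (symmLaurentToLaurent n ∘
      algebraMap (MvPolynomial.symmetricSubalgebra (Fin n) ℂ) (symmLaurent n)) := by
    have he : symmLaurentToLaurent n ∘
        algebraMap (MvPolynomial.symmetricSubalgebra (Fin n) ℂ) (symmLaurent n) =
        fun p : MvPolynomial.symmetricSubalgebra (Fin n) ℂ =>
          SymmLaurent.toLaurent n (p : MvPolynomial (Fin n) ℂ) :=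
      _root_.funext (symmLaurentToLaurent_algebraMap n)
    rw [he]
    exact (SymmLaurent.toLaurent_injective n).comp Subtype.val_injective
  exact h.of_comp

end Laurent

namespace SatakeGL

/-! ### Counting: antitone exponents of size `m` versus monomials of weighted degree `m` -/

section Counting

variable (n : ℕ)

/-- The next value `a_{i+1}` of a sequence on `Fin n` (`0` past the end). [folklore] -/
def nextVal (a : Fin n → ℕ) (i : Fin n) : ℕ := if h : (i : ℕ) + 1 < n then a ⟨(i : ℕ) + 1, h⟩ else 0

/-- The difference sequence `b_i = a_i - a_{i+1}` (`a_n = 0`) of `a ∈ ℕⁿ`: for antitone `a` the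
multiplicities with which `a = ∑_i b_i (1^{i+1} 0^{n-i-1})` is a sum of fundamental coweights.
[folklore] -/
def diffSeq (a : Fin n → ℕ) : Fin n → ℕ := fun i => a i - nextVal n a i

/-- Partial sums from the right: `∑_{j ≥ i} b_j`. [folklore] -/
def tailSum (b : Fin n → ℕ) (i : Fin n) : ℕ := ∑ j ∈ Finset.Ici i, b j

variable {n}

/-- `∑_i ∑_{j ≥ i} b_j = ∑_j (j + 1) b_j`. [folklore] -/
theorem sum_tailSum (b : Fin n → ℕ) : ∑ i, tailSum n b i = ∑ j : Fin n, ((j : ℕ) + 1) * b j := by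
  unfold tailSum
  rw [Finset.sum_comm' (t' := univ) (s' := fun j => Finset.Iic j)]
  · refine Finset.sum_congr rfl fun j _ => ?_
    rw [Finset.sum_const, smul_eq_mul, Fin.card_Iic]
  · intro i j
    simp only [Finset.mem_univ, true_and, and_true, Finset.mem_Ici, Finset.mem_Iic]

/-- `nextVal` at `castSucc i` is `a (succ i)`. [folklore] -/
theorem nextVal_castSucc {m : ℕ} (a : Fin (m + 1) → ℕ) (i : Fin m) :
    nextVal (m + 1) a (Fin.castSucc i) = a i.succ := by
  unfold nextVal
  rw [dif_pos (by simp [i.is_lt])]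
  congr 1

/-- `nextVal` at the last index is `0`. [folklore] -/
theorem nextVal_last {m : ℕ} (a : Fin (m + 1) → ℕ) : nextVal (m + 1) a (Fin.last m) = 0 := by
  unfold nextVal
  rw [dif_neg (by simp)]

/-- `Ici (castSucc i) = {castSucc i} ∪ Ici (succ i)` in `Fin (m+1)`. [folklore] -/
theorem Ici_castSucc_eq_insert {m : ℕ} (i : Fin m) :
    Finset.Ici (Fin.castSucc i) = insert (Fin.castSucc i) (Finset.Ici i.succ) := by
  ext j
  rw [Finset.mem_insert, Finset.mem_Ici, Finset.mem_Ici]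
  constructor
  · intro h
    rcases h.lt_or_eq with h | h
    · exact Or.inr (Fin.castSucc_lt_iff_succ_le.mp h)
    · exact Or.inl h.symm
  · rintro (rfl | h)
    · exact le_rfl
    · exact (Fin.castSucc_lt_iff_succ_le.mpr h).le

/-- **Telescoping**: for antitone `a`, `∑_{j ≥ i} (a_j - a_{j+1}) = a_i`. [folklore] -/
theorem tailSum_diffSeq {a : Fin n → ℕ} (ha : Antitone a) (i : Fin n) :
    tailSum n (diffSeq n a) i = a i := by
  cases n with
  | zero => exact i.elim0
  | succ m =>
    induction i using Fin.reverseInduction with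
    | last =>
      unfold tailSum diffSeq
      rw [show Finset.Ici (Fin.last m) = {Fin.last m} by ext j; simp [Fin.last_le_iff],
        Finset.sum_singleton, nextVal_last, Nat.sub_zero]
    | cast i ih =>
      unfold tailSum at ih ⊢
      rw [Ici_castSucc_eq_insert, Finset.sum_insert (by simp), ih]
      unfold diffSeq
      rw [nextVal_castSucc, Nat.sub_add_cancel (ha (Fin.castSucc_lt_succ (i := i)).le)]

/-- `diffSeq` is injective on antitone sequences. [folklore] -/
theorem diffSeq_injOn : Set.InjOn (diffSeq n) {a : Fin n → ℕ | Antitone a} := by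
  intro a ha a' ha' h
  funext i
  rw [← tailSum_diffSeq ha i, ← tailSum_diffSeq ha' i, h]

/-- The weighted degree of `diffSeq a` is `|a|`: `∑_j (j+1)(a_j - a_{j+1}) = ∑_i a_i`. [folklore] -/
theorem sum_succ_mul_diffSeq {a : Fin n → ℕ} (ha : Antitone a) :
    ∑ j : Fin n, ((j : ℕ) + 1) * diffSeq n a j = ∑ i, a i := by
  rw [← sum_tailSum]
  exact Finset.sum_congr rfl fun i _ => tailSum_diffSeq ha i

variable (n)

/-- The antitone `a ∈ ℕⁿ` with `∑ a_i = m` (sorted exponents of the double cosets in `Δ_m`).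
[folklore] -/
def antitoneTuples (m : ℕ) : Finset (Fin n → ℕ) :=
  (Finset.Nat.antidiagonalTuple n m).filter fun a => Antitone a

/-- Membership in `antitoneTuples`. [folklore] -/
theorem mem_antitoneTuples {m : ℕ} {a : Fin n → ℕ} :
    a ∈ antitoneTuples n m ↔ Antitone a ∧ ∑ i, a i = m := by
  unfold antitoneTuples
  rw [Finset.mem_filter, Finset.Nat.mem_antidiagonalTuple, and_comm]

/-- The `b ∈ ℕⁿ` of weighted degree `∑_j (j+1) b_j = m` (exponents of the monomials
`e_1^{b_0} ⋯ e_n^{b_{n-1}}` of degree `m`). [folklore] -/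
def weightedTuples (m : ℕ) : Finset (Fin n → ℕ) :=
  ((Finset.range (m + 1)).biUnion fun k => Finset.Nat.antidiagonalTuple n k).filter
    fun b => ∑ j : Fin n, ((j : ℕ) + 1) * b j = m

/-- Membership in `weightedTuples`. [folklore] -/
theorem mem_weightedTuples {m : ℕ} {b : Fin n → ℕ} :
    b ∈ weightedTuples n m ↔ ∑ j : Fin n, ((j : ℕ) + 1) * b j = m := by
  unfold weightedTuples
  rw [Finset.mem_filter, Finset.mem_biUnion]
  constructor
  · exact fun h => h.2
  · intro h
    refine ⟨⟨∑ j, b j, ?_, (Finset.Nat.mem_antidiagonalTuple).2 rfl⟩, h⟩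
    rw [Finset.mem_range, Nat.lt_succ_iff, ← h]
    exact Finset.sum_le_sum fun j _ => Nat.le_mul_of_pos_left _ (Nat.succ_pos _)

/-- **The count**: `#{a antitone, |a| = m} ≤ #{b : ∑ (j+1) b_j = m}` (in fact equality), via
`a ↦ diffSeq a`. [folklore] -/
theorem card_antitoneTuples_le (m : ℕ) :
    (antitoneTuples n m).card ≤ (weightedTuples n m).card := by
  refine Finset.card_le_card_of_injOn (diffSeq n) (fun a ha => ?_) fun a ha a' ha' h => ?_
  · rw [Finset.mem_coe, mem_antitoneTuples] at ha
    rw [Finset.mem_coe, mem_weightedTuples, sum_succ_mul_diffSeq ha.1, ha.2]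
  · rw [Finset.mem_coe, mem_antitoneTuples] at ha ha'
    exact diffSeq_injOn ha.1 ha'.1 h

/-- `P_m ⊆ ℂ[y_1, …, y_n]`: the span of the monomials `y^b` of weighted degree
`∑ (j+1) b_j = m`. [folklore] -/
def polyGrade (m : ℕ) : Submodule ℂ (MvPolynomial (Fin n) ℂ) :=
  Submodule.span ℂ ((weightedTuples n m).image fun b : Fin n → ℕ =>
    monomial (Finsupp.equivFunOnFinite.symm b) (1 : ℂ))

/-- `dim P_m = #{b : ∑ (j+1) b_j = m}` (monomials are linearly independent). [folklore] -/
theorem finrank_polyGrade (m : ℕ) : Module.finrank ℂ (polyGrade n m) = (weightedTuples n m).card := by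
  have hli : LinearIndependent ℂ (fun b : weightedTuples n m =>
      monomial (Finsupp.equivFunOnFinite.symm (b : Fin n → ℕ)) (1 : ℂ)) := by
    have h := (MvPolynomial.basisMonomials (Fin n) ℂ).linearIndependent.comp
      (fun b : weightedTuples n m => Finsupp.equivFunOnFinite.symm (b : Fin n → ℕ))
      (Finsupp.equivFunOnFinite.symm.injective.comp Subtype.val_injective)
    rwa [MvPolynomial.coe_basisMonomials] at h
  have hrange : Set.range (fun b : weightedTuples n m =>
      monomial (Finsupp.equivFunOnFinite.symm (b : Fin n → ℕ)) (1 : ℂ)) =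
      ((weightedTuples n m).image fun b : Fin n → ℕ =>
        monomial (Finsupp.equivFunOnFinite.symm b) (1 : ℂ)) := by
    rw [Finset.coe_image, Set.image_eq_range]
    exact rfl
  rw [polyGrade, ← hrange, finrank_span_eq_card hli, Fintype.card_coe]

end Counting

/-! ### The grading of `ℋ(G, K)` by the determinant -/

section Grade

variable {n : ℕ} {F : Type u} [Field F] [ValuativeRel F] {ϖ : F}
  [IsHeckeTriple (⊤ : Submonoid (GL (Fin n) F)) (glInt n F) (glInt n F)]

/-- `A_m = span {T_g : g ∈ Δ_m}`, `Δ_m` the integral matrices with `|det| = |ϖ|^m`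
(`glIntDet`). [folklore] -/
def heckeGrade (m : ℕ) : Submodule ℂ (heckeAlgebra ℂ (GL (Fin n) F) (glInt n F)) :=
  Submodule.span ℂ (heckeAlgebra.doubleCosetOperator (k := ℂ) (glInt n F) '' glIntDet n ϖ m)

/-- `T_g ∈ A_m` for `g ∈ Δ_m`. [folklore] -/
theorem doubleCosetOperator_mem_heckeGrade {m : ℕ} {g : GL (Fin n) F} (hg : g ∈ glIntDet n ϖ m) :
    heckeAlgebra.doubleCosetOperator (k := ℂ) (glInt n F) g ∈ heckeGrade (ϖ := ϖ) m :=
  Submodule.subset_span ⟨g, hg, rfl⟩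

/-- `1 ∈ A_0`. [folklore] -/
theorem one_mem_heckeGrade_zero : (1 : heckeAlgebra ℂ (GL (Fin n) F) (glInt n F)) ∈
    heckeGrade (ϖ := ϖ) 0 := by
  rw [← heckeAlgebra.doubleCosetOperator_one]
  exact doubleCosetOperator_mem_heckeGrade ((mem_delta_zero_iff _).2 (Subgroup.one_mem _))

/-- **Products of double-coset operators are graded**: `T_g T_h ∈ A_{a+b}` for `g ∈ Δ_a`,
`h ∈ Δ_b` — the support of `(T_g T_h) [K]` lies in `KhK·KgK/K ⊆ Δ_{a+b} K/K`
(`exists_eq_out_smul_of_coeff_ne_zero`, `mul_mem_delta`; Shimura (1971), Prop. 3.15 and the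
homogeneity in the proof of Thm. 3.20). [folklore] -/
theorem doubleCosetOperator_mul_mem_heckeGrade {a b : ℕ} {g h : GL (Fin n) F}
    (hg : g ∈ glIntDet n ϖ a) (hh : h ∈ glIntDet n ϖ b) :
    heckeAlgebra.doubleCosetOperator (k := ℂ) (glInt n F) g *
        heckeAlgebra.doubleCosetOperator (glInt n F) h ∈ heckeGrade (ϖ := ϖ) (a + b) := by
  refine Submodule.span_le.2 ?_ (heckeAlgebra.mem_span_doubleCosetOperator (glInt n F) _)
  rintro _ ⟨γ, hγ, rfl⟩
  rw [Finset.mem_coe, Finsupp.mem_support_iff] at hγ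
  obtain ⟨β, hβ, α, hα, rfl⟩ := heckeAlgebra.exists_eq_out_smul_of_coeff_ne_zero (glInt n F) hγ
  refine doubleCosetOperator_mem_heckeGrade ?_
  rw [smul_out_mem_glIntDet_iff', add_comm]
  -- `β.out ∈ Δ_b`, `α.out ∈ Δ_a`
  obtain ⟨κ, rfl⟩ := MulAction.mem_orbit_iff.1 hβ
  obtain ⟨κ', rfl⟩ := MulAction.mem_orbit_iff.1 hα
  have hβ' : (κ • (h : GL (Fin n) F ⧸ glInt n F)).out ∈ glIntDet n ϖ b := by
    rw [smul_out_mem_glIntDet_iff, mk_out_mem_glIntDet_iff]; exact hh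
  have hα' : (κ' • (g : GL (Fin n) F ⧸ glInt n F)).out ∈ glIntDet n ϖ a := by
    rw [smul_out_mem_glIntDet_iff, mk_out_mem_glIntDet_iff]; exact hg
  exact mul_mem_delta hβ' hα'

/-- `A_a A_b ⊆ A_{a+b}`. [folklore] -/
theorem mul_mem_heckeGrade {a b : ℕ} {S T : heckeAlgebra ℂ (GL (Fin n) F) (glInt n F)}
    (hS : S ∈ heckeGrade (ϖ := ϖ) a) (hT : T ∈ heckeGrade (ϖ := ϖ) b) :
    S * T ∈ heckeGrade (ϖ := ϖ) (a + b) := by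
  have h := Submodule.mul_mem_mul hS hT
  rw [heckeGrade, heckeGrade, Submodule.span_mul_span] at h
  refine Submodule.span_le.2 ?_ h
  rintro _ ⟨_, ⟨g, hg, rfl⟩, _, ⟨h', hh', rfl⟩, rfl⟩
  exact doubleCosetOperator_mul_mem_heckeGrade hg hh'

end Grade

/-! ### The inverse Satake map `θ` -/

section Inverse

variable {n : ℕ} {F : Type u} [Field F] [ValuativeRel F] [IsDiscreteValuationRing 𝒪[F]]
  [Finite 𝓀[F]] {ϖ : F} (hϖ : IsUniformizingElement ϖ)
  [IsHeckeTriple (⊤ : Submonoid (GL (Fin n) F)) (glInt n F) (glInt n F)]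
  [IsMulCommutative (heckeAlgebra ℂ (GL (Fin n) F) (glInt n F))]

/-- The normalised generator `q^{r(r-1)/2} T_r` of `ℋ(G, K)` (`T_r` the double-coset operator of
`diag(ϖ 1_r, 1_{n-r})`), the image of `e_r` under the inverse Satake map. [folklore] -/
def satakeInvGen (r : ℕ) : heckeAlgebra ℂ (GL (Fin n) F) (glInt n F) :=
  ((Nat.card 𝓀[F] : ℂ) ^ (r * (r - 1) / 2)) •
    heckeAlgebra.doubleCosetOperator (glInt n F) (heckeDiag n (Units.mk0 ϖ hϖ.ne_zero) r)

omit [IsMulCommutative (heckeAlgebra ℂ (GL (Fin n) F) (glInt n F))] in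
/-- **`𝒮(q^{r(r-1)/2} T_r) = e_r(x)`** (`satakeTransform_doubleCosetOperator_heckeDiag`). [folklore] -/
theorem satakeTransform_satakeInvGen {r : ℕ} (hr : r ≤ n) :
    satakeTransform hϖ (satakeInvGen hϖ r) = SymmLaurent.toLaurent n (esymm (Fin n) ℂ r) := by
  rw [satakeInvGen, map_smul, satakeTransform_doubleCosetOperator_heckeDiag hϖ hr, smul_smul,
    mul_inv_cancel₀ (pow_ne_zero _ natCard_residueField_ne_zero), one_smul, SymmLaurent.toLaurent_esymm]

variable (n) in
open scoped IsMulCommutative in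
/-- `θ₀ : ℂ[y_1, …, y_n] → ℋ(G, K)`, `y_i ↦ q^{i(i+1)/2} T_{i+1}` (uses the commutativity of
`ℋ(G, K)`, `IsMulCommutative`, through `MvPolynomial.aeval`). [folklore] -/
def satakeInvPoly : MvPolynomial (Fin n) ℂ →ₐ[ℂ] heckeAlgebra ℂ (GL (Fin n) F) (glInt n F) :=
  MvPolynomial.aeval fun i : Fin n => satakeInvGen hϖ ((i : ℕ) + 1)

omit [Finite 𝓀[F]] in
open scoped IsMulCommutative in
/-- `θ₀ (y_i) = q^{…} T_{i+1}`. [folklore] -/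
@[simp]
theorem satakeInvPoly_X (i : Fin n) : satakeInvPoly n hϖ (X i) = satakeInvGen hϖ ((i : ℕ) + 1) := by
  rw [satakeInvPoly, aeval_X]

/-- `θ₁ : ℂ[x]^{S_n} → ℋ(G, K)`, `e_r ↦ q^{r(r-1)/2} T_r`, through the fundamental theorem of
symmetric polynomials `MvPolynomial.esymmAlgEquiv`. [folklore] -/
def satakeInvSymm :
    MvPolynomial.symmetricSubalgebra (Fin n) ℂ →ₐ[ℂ] heckeAlgebra ℂ (GL (Fin n) F) (glInt n F) :=
  (satakeInvPoly n hϖ).comp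
    (MvPolynomial.esymmAlgEquiv (Fin n) ℂ (Fintype.card_fin n)).symm.toAlgHom

omit [Finite 𝓀[F]] in
/-- `θ₁ (e_{i+1}) = q^{i(i+1)/2} T_{i+1}`. [folklore] -/
theorem satakeInvSymm_esymm (i : Fin n) :
    satakeInvSymm hϖ ⟨esymm (Fin n) ℂ ((i : ℕ) + 1), esymm_isSymmetric _ _ _⟩ =
      satakeInvGen hϖ ((i : ℕ) + 1) := by
  change satakeInvPoly n hϖ ((MvPolynomial.esymmAlgEquiv (Fin n) ℂ (Fintype.card_fin n)).symm
    ⟨esymm (Fin n) ℂ ((i : ℕ) + 1), esymm_isSymmetric _ _ _⟩) = _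
  rw [MvPolynomial.esymmAlgEquiv_symm_apply, satakeInvPoly_X]

/-- `𝒮 ∘ θ₀ = toLaurent ∘ esymmAlgEquiv` on `ℂ[y]`: both send `y_i ↦ e_{i+1}(x)`. [folklore] -/
theorem satakeTransform_comp_satakeInvPoly :
    (satakeTransform hϖ).comp (satakeInvPoly n hϖ) =
      ((SymmLaurent.toLaurent n).comp (MvPolynomial.symmetricSubalgebra (Fin n) ℂ).val).comp
        (MvPolynomial.esymmAlgEquiv (Fin n) ℂ (Fintype.card_fin n)).toAlgHom := by
  refine MvPolynomial.algHom_ext fun i => ?_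
  have hi := i.is_lt
  change satakeTransform hϖ (satakeInvPoly n hϖ (X i)) = SymmLaurent.toLaurent n
    ((MvPolynomial.esymmAlgEquiv (Fin n) ℂ (Fintype.card_fin n) (X i) :
      MvPolynomial.symmetricSubalgebra (Fin n) ℂ) : MvPolynomial (Fin n) ℂ)
  rw [satakeInvPoly_X, satakeTransform_satakeInvGen hϖ (by omega), MvPolynomial.esymmAlgEquiv_apply,
    MvPolynomial.esymmAlgHom, aeval_X]

/-- `𝒮 ∘ θ₁ = toLaurent` on the symmetric polynomials. [folklore] -/
theorem satakeTransform_satakeInvSymm (p : MvPolynomial.symmetricSubalgebra (Fin n) ℂ) :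
    satakeTransform hϖ (satakeInvSymm hϖ p) = SymmLaurent.toLaurent n (p : MvPolynomial (Fin n) ℂ) := by
  have h := AlgHom.congr_fun (satakeTransform_comp_satakeInvPoly hϖ)
    ((MvPolynomial.esymmAlgEquiv (Fin n) ℂ (Fintype.card_fin n)).symm p)
  change satakeTransform hϖ (satakeInvPoly n hϖ ((MvPolynomial.esymmAlgEquiv (Fin n) ℂ
      (Fintype.card_fin n)).symm p)) = SymmLaurent.toLaurent n ((MvPolynomial.esymmAlgEquiv (Fin n) ℂ
      (Fintype.card_fin n) ((MvPolynomial.esymmAlgEquiv (Fin n) ℂ (Fintype.card_fin n)).symm p) :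
        MvPolynomial.symmetricSubalgebra (Fin n) ℂ) : MvPolynomial (Fin n) ℂ) at h
  rw [AlgEquiv.apply_symm_apply] at h
  rw [← h]
  rfl

omit [IsDiscreteValuationRing 𝒪[F]] [Finite 𝓀[F]]
  [IsMulCommutative (heckeAlgebra ℂ (GL (Fin n) F) (glInt n F))] in
/-- `T_{ϖ·1} T_{(ϖ·1)⁻¹} = 1`: the operator of the central double coset is a unit. [folklore] -/
theorem doubleCosetOperator_heckeDiag_self_mul_inv :
    heckeAlgebra.doubleCosetOperator (k := ℂ) (glInt n F) (heckeDiag n (Units.mk0 ϖ hϖ.ne_zero) n) *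
      heckeAlgebra.doubleCosetOperator (glInt n F) (heckeDiag n (Units.mk0 ϖ hϖ.ne_zero) n)⁻¹ = 1 := by
  rw [heckeAlgebra.doubleCosetOperator_central_mul (glInt n F)
    (mul_heckeDiag_self_comm (Units.mk0 ϖ hϖ.ne_zero)), mul_inv_cancel,
    heckeAlgebra.doubleCosetOperator_one]

omit [IsDiscreteValuationRing 𝒪[F]] [Finite 𝓀[F]]
  [IsMulCommutative (heckeAlgebra ℂ (GL (Fin n) F) (glInt n F))] in
/-- `T_{(ϖ·1)⁻¹} T_{ϖ·1} = 1`. [folklore] -/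
theorem doubleCosetOperator_heckeDiag_inv_mul_self :
    heckeAlgebra.doubleCosetOperator (k := ℂ) (glInt n F) (heckeDiag n (Units.mk0 ϖ hϖ.ne_zero) n)⁻¹ *
      heckeAlgebra.doubleCosetOperator (glInt n F) (heckeDiag n (Units.mk0 ϖ hϖ.ne_zero) n) = 1 := by
  have hz : ∀ x : GL (Fin n) F, x * (heckeDiag n (Units.mk0 ϖ hϖ.ne_zero) n)⁻¹ =
      (heckeDiag n (Units.mk0 ϖ hϖ.ne_zero) n)⁻¹ * x := fun x =>
    (Commute.inv_right (show Commute x (heckeDiag n (Units.mk0 ϖ hϖ.ne_zero) n) from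
      mul_heckeDiag_self_comm _ x)).eq
  rw [heckeAlgebra.doubleCosetOperator_central_mul (glInt n F) hz, inv_mul_cancel,
    heckeAlgebra.doubleCosetOperator_one]

omit [Finite 𝓀[F]] in
/-- `θ₁ (e_n) = q^{n(n-1)/2} T_{ϖ·1}` (for `n = 0` both sides are `1`). [folklore] -/
theorem satakeInvSymm_esymmTop : satakeInvSymm hϖ (esymmTop n) = satakeInvGen hϖ n := by
  cases n with
  | zero =>
    have h0 : esymmTop 0 = 1 := Subtype.ext (by rw [coe_esymmTop, esymm_zero]; rfl)
    have h1 : heckeDiag 0 (Units.mk0 ϖ hϖ.ne_zero) 0 = 1 := Units.ext (Subsingleton.elim _ _)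
    rw [h0, map_one, satakeInvGen, h1, heckeAlgebra.doubleCosetOperator_one]
    simp
  | succ m =>
    have h : esymmTop (m + 1) = ⟨esymm (Fin (m + 1)) ℂ (((Fin.last m : Fin (m + 1)) : ℕ) + 1),
        esymm_isSymmetric _ _ _⟩ := Subtype.ext (by rw [coe_esymmTop, Fin.val_last])
    rw [h, satakeInvSymm_esymm, Fin.val_last]

/-- `θ₁ (e_n)` is a unit of `ℋ(G, K)` (`T_{ϖ·1}` is). [folklore] -/
theorem isUnit_satakeInvSymm_esymmTop : IsUnit (satakeInvSymm hϖ (esymmTop n)) := by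
  rw [satakeInvSymm_esymmTop, satakeInvGen, Algebra.smul_def]
  refine ((isUnit_iff_ne_zero.2 (pow_ne_zero _ natCard_residueField_ne_zero)).map
    (algebraMap ℂ _)).mul (isUnit_iff_exists.2 ⟨_, doubleCosetOperator_heckeDiag_self_mul_inv hϖ,
      doubleCosetOperator_heckeDiag_inv_mul_self hϖ⟩)

variable (n) in
open scoped IsMulCommutative in
/-- **The inverse Satake map** `θ : ℂ[e_1, …, e_n][e_n⁻¹] →ₐ[ℂ] ℋ(GL_n(F), GL_n(𝒪))`,
`e_r ↦ q^{r(r-1)/2} T_r` (`e_n⁻¹ ↦` the inverse of the unit `q^{…} T_{ϖ·1}`), by the universal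
property of the localisation; it will be shown to be an isomorphism (`satakeAlgEquiv`).
[folklore] -/
def satakeInv : symmLaurent n →ₐ[ℂ] heckeAlgebra ℂ (GL (Fin n) F) (glInt n F) :=
  IsLocalization.Away.liftAlgHom (S := symmLaurent n) (esymmTop n) (f := satakeInvSymm hϖ)
    (isUnit_satakeInvSymm_esymmTop hϖ)

open scoped IsMulCommutative in
/-- `θ` on the image of a symmetric polynomial. [folklore] -/
theorem satakeInv_algebraMap (p : MvPolynomial.symmetricSubalgebra (Fin n) ℂ) :
    satakeInv n hϖ (algebraMap _ (symmLaurent n) p) = satakeInvSymm hϖ p := by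
  unfold satakeInv
  rw [IsLocalization.Away.coe_liftAlgHom, IsLocalization.Away.lift_eq]
  rfl

/-- `θ ∘ algebraMap ∘ esymmAlgEquiv = θ₀`. [folklore] -/
theorem satakeInv_algebraMap_esymmAlgEquiv (p : MvPolynomial (Fin n) ℂ) :
    satakeInv n hϖ (algebraMap _ (symmLaurent n)
      (MvPolynomial.esymmAlgEquiv (Fin n) ℂ (Fintype.card_fin n) p)) = satakeInvPoly n hϖ p := by
  rw [satakeInv_algebraMap]
  change satakeInvPoly n hϖ ((MvPolynomial.esymmAlgEquiv (Fin n) ℂ (Fintype.card_fin n)).symm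
    (MvPolynomial.esymmAlgEquiv (Fin n) ℂ (Fintype.card_fin n) p)) = _
  rw [AlgEquiv.symm_apply_apply]

/-- **`𝒮 ∘ θ = ι`**: the Satake transform inverts `θ` onto the embedding
`ℂ[e][e_n⁻¹] ↪ ℂ[ℤⁿ]`. [folklore] -/
theorem satakeTransform_comp_satakeInv :
    (satakeTransform hϖ).comp (satakeInv n hϖ) = symmLaurentToLaurent n := by
  apply AlgHom.coe_ringHom_injective
  refine IsLocalization.ringHom_ext (Submonoid.powers (esymmTop n)) (RingHom.ext fun p => ?_)
  change satakeTransform hϖ (satakeInv n hϖ (algebraMap _ (symmLaurent n) p)) =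
    symmLaurentToLaurent n (algebraMap _ (symmLaurent n) p)
  rw [satakeInv_algebraMap, satakeTransform_satakeInvSymm, symmLaurentToLaurent_algebraMap]

/-- **`θ` is injective** (because `𝒮 ∘ θ = ι` is). [folklore] -/
theorem satakeInv_injective : Function.Injective (satakeInv n hϖ) := by
  have h : Function.Injective (satakeTransform hϖ ∘ satakeInv n hϖ) := by
    rw [← AlgHom.coe_comp, satakeTransform_comp_satakeInv]
    exact symmLaurentToLaurent_injective n
  exact h.of_comp

/-- `θ₀` is injective. [folklore] -/
theorem satakeInvPoly_injective : Function.Injective (satakeInvPoly n hϖ) := by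
  intro p p' h
  rw [← satakeInv_algebraMap_esymmAlgEquiv, ← satakeInv_algebraMap_esymmAlgEquiv] at h
  exact (MvPolynomial.esymmAlgEquiv (Fin n) ℂ (Fintype.card_fin n)).injective
    (algebraMap_symmLaurent_injective n (satakeInv_injective hϖ h))

omit [IsDiscreteValuationRing 𝒪[F]] [Finite 𝓀[F]]
  [IsMulCommutative (heckeAlgebra ℂ (GL (Fin n) F) (glInt n F))] in
/-- `x ∈ A_d ⇒ x^e ∈ A_{d e}`. [folklore] -/
theorem pow_mem_heckeGrade {d : ℕ} {x : heckeAlgebra ℂ (GL (Fin n) F) (glInt n F)}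
    (hx : x ∈ heckeGrade (ϖ := ϖ) d) (e : ℕ) : x ^ e ∈ heckeGrade (ϖ := ϖ) (d * e) := by
  induction e with
  | zero => rw [pow_zero, mul_zero]; exact one_mem_heckeGrade_zero
  | succ e ih => rw [pow_succ, Nat.mul_succ]; exact mul_mem_heckeGrade ih hx

omit [IsDiscreteValuationRing 𝒪[F]] [Finite 𝓀[F]] in
open scoped IsMulCommutative in
/-- Products over a finset are graded. [folklore] -/
theorem prod_mem_heckeGrade {ι : Type*} (s : Finset ι)
    (x : ι → heckeAlgebra ℂ (GL (Fin n) F) (glInt n F)) (d : ι → ℕ)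
    (h : ∀ i ∈ s, x i ∈ heckeGrade (ϖ := ϖ) (d i)) :
    ∏ i ∈ s, x i ∈ heckeGrade (ϖ := ϖ) (∑ i ∈ s, d i) := by
  classical
  induction s using Finset.induction_on with
  | empty => rw [Finset.prod_empty, Finset.sum_empty]; exact one_mem_heckeGrade_zero
  | insert i s hi ih =>
    rw [Finset.prod_insert hi, Finset.sum_insert hi]
    exact mul_mem_heckeGrade (h i (Finset.mem_insert_self i s))
      (ih fun j hj => h j (Finset.mem_insert_of_mem hj))

omit [Finite 𝓀[F]] [IsMulCommutative (heckeAlgebra ℂ (GL (Fin n) F) (glInt n F))] in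
/-- `q^{r(r-1)/2} T_r ∈ A_r` (`r ≤ n`). [folklore] -/
theorem satakeInvGen_mem_heckeGrade {r : ℕ} (hr : r ≤ n) :
    satakeInvGen hϖ r ∈ heckeGrade (n := n) (ϖ := ϖ) r := by
  unfold satakeInvGen
  refine Submodule.smul_mem _ _ ?_
  exact doubleCosetOperator_mem_heckeGrade (heckeDiag_mem_glIntDet hϖ hr)

omit [Finite 𝓀[F]] in
open scoped IsMulCommutative in
/-- **`θ₀` respects the gradings**: `θ₀ (y^b) ∈ A_{∑ (j+1) b_j}`. [folklore] -/
theorem satakeInvPoly_monomial_mem_heckeGrade (b : Fin n →₀ ℕ) :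
    satakeInvPoly n hϖ (monomial b 1) ∈ heckeGrade (ϖ := ϖ) (∑ j : Fin n, ((j : ℕ) + 1) * b j) := by
  rw [satakeInvPoly, aeval_monomial, map_one, one_mul,
    Finsupp.prod_fintype _ _ (fun i => by rw [pow_zero])]
  exact prod_mem_heckeGrade _ _ _ fun j _ =>
    pow_mem_heckeGrade (satakeInvGen_mem_heckeGrade hϖ (by have := j.is_lt; omega)) (b j)

omit [Finite 𝓀[F]] [IsMulCommutative (heckeAlgebra ℂ (GL (Fin n) F) (glInt n F))] in
/-- **Dimension bound from the Cartan decomposition**: `A_m` lies in the span of the `T_{ϖ^a}`,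
`a` antitone with `|a| = m`, since every `T_g`, `g ∈ Δ_m`, is such a `T_{ϖ^a}`
(`exists_glInt_mul_mul_eq_piPowGL_of_mem_glIntDet`). [folklore] -/
theorem heckeGrade_le_span_antitoneTuples (m : ℕ) :
    heckeGrade (ϖ := ϖ) m ≤ Submodule.span ℂ (Set.range fun a : antitoneTuples n m =>
      heckeAlgebra.doubleCosetOperator (k := ℂ) (glInt n F) (piPowGL hϖ.ne_zero (a : Fin n → ℕ))) := by
  refine Submodule.span_le.2 ?_
  rintro _ ⟨g, hg, rfl⟩
  obtain ⟨k₁, hk₁, k₂, hk₂, a, ha, hsum, h⟩ := exists_glInt_mul_mul_eq_piPowGL_of_mem_glIntDet hϖ hg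
  refine Submodule.subset_span ⟨⟨a, (mem_antitoneTuples n).2 ⟨ha, hsum⟩⟩, ?_⟩
  change heckeAlgebra.doubleCosetOperator (glInt n F) (piPowGL hϖ.ne_zero a) = _
  rw [← h, heckeAlgebra.doubleCosetOperator_mul_mul_eq (glInt n F) hk₁ hk₂]

/-! The dimension count is carried out on the vectors `T [K] ∈ ℂ[G ⧸ K]` (through the injective
`heckeAlgebra.toVector`), where the linear algebra instances are the plain ones of `MonoidAlgebra`. -/

omit [Finite 𝓀[F]] [IsMulCommutative (heckeAlgebra ℂ (GL (Fin n) F) (glInt n F))] in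
/-- `A_m [K]` lies in the span of the finitely many `𝟙_{K ϖ^a K}`, `a` antitone, `|a| = m`.
[folklore] -/
theorem map_toVector_heckeGrade_le (m : ℕ) :
    Submodule.map (heckeAlgebra.toVector (k := ℂ) (glInt n F)) (heckeGrade (ϖ := ϖ) m) ≤
      Submodule.span ℂ (Set.range fun a : antitoneTuples n m =>
        heckeAlgebra.toVector (glInt n F) (heckeAlgebra.doubleCosetOperator (k := ℂ) (glInt n F)
          (piPowGL hϖ.ne_zero (a : Fin n → ℕ)))) := by
  refine (Submodule.map_mono (heckeGrade_le_span_antitoneTuples hϖ m)).trans ?_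
  rw [Submodule.map_span, ← Set.range_comp]
  rfl

omit [Finite 𝓀[F]] [IsMulCommutative (heckeAlgebra ℂ (GL (Fin n) F) (glInt n F))] in
include hϖ in
/-- `A_m [K]` is finite-dimensional. [folklore] -/
theorem finiteDimensional_map_toVector_heckeGrade (m : ℕ) :
    FiniteDimensional ℂ (Submodule.map (heckeAlgebra.toVector (k := ℂ) (glInt n F))
      (heckeGrade (ϖ := ϖ) m)) :=
  haveI := FiniteDimensional.span_of_finite ℂ (Set.finite_range fun a : antitoneTuples n m =>
    heckeAlgebra.toVector (glInt n F) (heckeAlgebra.doubleCosetOperator (k := ℂ) (glInt n F)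
      (piPowGL hϖ.ne_zero (a : Fin n → ℕ))))
  Submodule.finiteDimensional_of_le (map_toVector_heckeGrade_le hϖ m)

omit [Finite 𝓀[F]] [IsMulCommutative (heckeAlgebra ℂ (GL (Fin n) F) (glInt n F))] in
include hϖ in
/-- **`dim A_m ≤ #{a antitone, |a| = m}`** (on vectors). [folklore] -/
theorem finrank_map_toVector_heckeGrade_le (m : ℕ) :
    Module.finrank ℂ (Submodule.map (heckeAlgebra.toVector (k := ℂ) (glInt n F))
      (heckeGrade (ϖ := ϖ) m)) ≤ (antitoneTuples n m).card := by
  haveI := FiniteDimensional.span_of_finite ℂ (Set.finite_range fun a : antitoneTuples n m =>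
    heckeAlgebra.toVector (glInt n F) (heckeAlgebra.doubleCosetOperator (k := ℂ) (glInt n F)
      (piPowGL hϖ.ne_zero (a : Fin n → ℕ))))
  refine (Submodule.finrank_mono (map_toVector_heckeGrade_le hϖ m)).trans ?_
  exact (finrank_range_le_card _).trans (Fintype.card_coe _).le

omit [Finite 𝓀[F]] in
/-- `θ₀ (P_m) ⊆ A_m`. [folklore] -/
theorem map_satakeInvPoly_polyGrade_le (m : ℕ) :
    Submodule.map (satakeInvPoly n hϖ).toLinearMap (polyGrade n m) ≤ heckeGrade (ϖ := ϖ) m := by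
  rw [polyGrade, Finset.coe_image, Submodule.map_span, Submodule.span_le]
  rintro _ ⟨_, ⟨b, hb, rfl⟩, rfl⟩
  rw [Finset.mem_coe, mem_weightedTuples] at hb
  have h := satakeInvPoly_monomial_mem_heckeGrade hϖ (Finsupp.equivFunOnFinite.symm b)
  simp only [Finsupp.coe_equivFunOnFinite_symm] at h
  rw [hb] at h
  exact h

/-- **`θ₀ (P_m) = A_m`** (on vectors), by the dimension count
`dim A_m ≤ #antitone ≤ #weighted = dim P_m` and injectivity of `θ₀` and `toVector`. [folklore] -/
theorem map_satakeInvPoly_polyGrade_eq (m : ℕ) :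
    Submodule.map (heckeAlgebra.toVector (k := ℂ) (glInt n F) ∘ₗ (satakeInvPoly n hϖ).toLinearMap)
        (polyGrade n m) =
      Submodule.map (heckeAlgebra.toVector (k := ℂ) (glInt n F)) (heckeGrade (ϖ := ϖ) m) := by
  haveI := finiteDimensional_map_toVector_heckeGrade (n := n) hϖ m
  have hle : Submodule.map (heckeAlgebra.toVector (k := ℂ) (glInt n F) ∘ₗ
      (satakeInvPoly n hϖ).toLinearMap) (polyGrade n m) ≤
      Submodule.map (heckeAlgebra.toVector (k := ℂ) (glInt n F)) (heckeGrade (ϖ := ϖ) m) := by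
    rw [Submodule.map_comp]
    exact Submodule.map_mono (map_satakeInvPoly_polyGrade_le hϖ m)
  refine Submodule.eq_of_le_of_finrank_le hle ?_
  have hinj : Function.Injective (heckeAlgebra.toVector (k := ℂ) (glInt n F) ∘ₗ
      (satakeInvPoly n hϖ).toLinearMap) :=
    (heckeAlgebra.toVector_injective (glInt n F)).comp (satakeInvPoly_injective hϖ)
  rw [← LinearEquiv.finrank_eq (Submodule.equivMapOfInjective _ hinj _), finrank_polyGrade]
  exact (finrank_map_toVector_heckeGrade_le hϖ m).trans (card_antitoneTuples_le n m)

/-- **Every `T_g` with `g` integral is in the image of `θ`.** [folklore] -/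
theorem doubleCosetOperator_mem_range_of_isIntegralMatrix {g : GL (Fin n) F}
    (hg : IsIntegralMatrix (g : Matrix (Fin n) (Fin n) F)) :
    heckeAlgebra.doubleCosetOperator (k := ℂ) (glInt n F) g ∈ (satakeInv n hϖ).range := by
  obtain ⟨k₁, hk₁, k₂, hk₂, a, -, h⟩ := exists_glInt_mul_mul_eq_piPowGL hϖ hg
  rw [← heckeAlgebra.doubleCosetOperator_mul_mul_eq (glInt n F) hk₁ hk₂, h]
  have hmem : heckeAlgebra.toVector (glInt n F)
      (heckeAlgebra.doubleCosetOperator (k := ℂ) (glInt n F) (piPowGL hϖ.ne_zero a)) ∈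
      Submodule.map (heckeAlgebra.toVector (k := ℂ) (glInt n F) ∘ₗ (satakeInvPoly n hϖ).toLinearMap)
        (polyGrade n (∑ i, a i)) := by
    rw [map_satakeInvPoly_polyGrade_eq]
    exact Submodule.mem_map_of_mem (doubleCosetOperator_mem_heckeGrade (piPowGL_mem_glIntDet hϖ a))
  obtain ⟨p, -, hp⟩ := Submodule.mem_map.1 hmem
  have hp' : satakeInvPoly n hϖ p =
      heckeAlgebra.doubleCosetOperator (k := ℂ) (glInt n F) (piPowGL hϖ.ne_zero a) :=
    heckeAlgebra.toVector_injective (glInt n F) hp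
  rw [← hp', ← satakeInv_algebraMap_esymmAlgEquiv]
  exact AlgHom.mem_range_self _ _

open scoped IsMulCommutative in
/-- **`T_{(ϖ·1)⁻¹}` is in the image of `θ`**: it is the inverse of the unit `T_{ϖ·1}`, and
`q^{n(n-1)/2} T_{ϖ·1} = θ(e_n)` with `e_n` a unit of `ℂ[e][e_n⁻¹]`. [folklore] -/
theorem doubleCosetOperator_heckeDiag_inv_mem_range :
    heckeAlgebra.doubleCosetOperator (k := ℂ) (glInt n F)
      (heckeDiag n (Units.mk0 ϖ hϖ.ne_zero) n)⁻¹ ∈ (satakeInv n hϖ).range := by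
  -- `u = e_n / 1`, a unit of the localisation, with `θ u = satakeInvSymm e_n`
  obtain ⟨u, hu⟩ := IsLocalization.Away.algebraMap_isUnit (S := symmLaurent n) (esymmTop n)
  set c : ℂ := (Nat.card 𝓀[F] : ℂ) ^ (n * (n - 1) / 2) with hc
  set T := heckeAlgebra.doubleCosetOperator (k := ℂ) (glInt n F) (heckeDiag n (Units.mk0 ϖ hϖ.ne_zero) n)
  set T' := heckeAlgebra.doubleCosetOperator (k := ℂ) (glInt n F)
    (heckeDiag n (Units.mk0 ϖ hϖ.ne_zero) n)⁻¹
  have hθu : satakeInv n hϖ u = c • T := by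
    rw [hu, satakeInv_algebraMap, satakeInvSymm_esymmTop]
    rfl
  have h1 : satakeInv n hϖ ↑u⁻¹ * (c • T) = 1 := by
    rw [← hθu, ← map_mul, Units.inv_mul, map_one]
  have h2 : T' * T = 1 := doubleCosetOperator_heckeDiag_inv_mul_self hϖ
  have key : T' = c • satakeInv n hϖ ↑u⁻¹ := by
    calc T' = T' * (satakeInv n hϖ ↑u⁻¹ * (c • T)) := by rw [h1, mul_one]
      _ = c • satakeInv n hϖ ↑u⁻¹ * (T' * T) := by
        rw [mul_smul_comm, mul_smul_comm, smul_mul_assoc, mul_left_comm, ← mul_assoc]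
      _ = c • satakeInv n hϖ ↑u⁻¹ := by rw [h2, mul_one]
  rw [key]
  exact Subalgebra.smul_mem _ (AlgHom.mem_range_self _ _) c

omit [IsDiscreteValuationRing 𝒪[F]] [Finite 𝓀[F]]
  [IsMulCommutative (heckeAlgebra ℂ (GL (Fin n) F) (glInt n F))] in
/-- `T_{z^{N+1}} = T_z T_{z^N}` for the central `z = (ϖ·1)⁻¹`; hence `T_{z^N} = T_z^N`. [folklore] -/
theorem doubleCosetOperator_heckeDiag_inv_pow (N : ℕ) :
    heckeAlgebra.doubleCosetOperator (k := ℂ) (glInt n F)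
        ((heckeDiag n (Units.mk0 ϖ hϖ.ne_zero) n)⁻¹ ^ N) =
      heckeAlgebra.doubleCosetOperator (glInt n F) (heckeDiag n (Units.mk0 ϖ hϖ.ne_zero) n)⁻¹ ^ N := by
  have hz : ∀ x : GL (Fin n) F, x * (heckeDiag n (Units.mk0 ϖ hϖ.ne_zero) n)⁻¹ =
      (heckeDiag n (Units.mk0 ϖ hϖ.ne_zero) n)⁻¹ * x := fun x =>
    ((Commute.inv_right (show Commute x (heckeDiag n (Units.mk0 ϖ hϖ.ne_zero) n) from
      mul_heckeDiag_self_comm _ x))).eq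
  induction N with
  | zero => rw [pow_zero, pow_zero, heckeAlgebra.doubleCosetOperator_one]
  | succ N ih => rw [pow_succ', pow_succ', ← heckeAlgebra.doubleCosetOperator_central_mul _ hz, ih]

omit [IsDiscreteValuationRing 𝒪[F]] [Finite 𝓀[F]] [IsHeckeTriple ⊤ (glInt n F) (glInt n F)]
  [IsMulCommutative (heckeAlgebra ℂ (GL (Fin n) F) (glInt n F))] in
/-- `(ϖ·1)^N` as a matrix is `ϖ^{(N, …, N)}`. [folklore] -/
theorem heckeDiag_self_pow_eq_zpowDiagGL (N : ℕ) :
    (heckeDiag n (Units.mk0 ϖ hϖ.ne_zero) n) ^ N = zpowDiagGL hϖ.ne_zero fun _ : Fin n => (N : ℤ) := by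
  refine Units.ext ?_
  rw [Units.val_pow_eq_pow_val, heckeDiag_self_eq_scalar, Matrix.GeneralLinearGroup.coe_scalar,
    coe_zpowDiagGL_const, Units.val_mk0, zpow_natCast, ← map_pow]

/-- **Every `T_g` is in the image of `θ`**: `T_g = T_{z^N} T_{(ϖ·1)^N g}` with `z = (ϖ·1)⁻¹`
central and `(ϖ·1)^N g` integral. [folklore] -/
theorem doubleCosetOperator_mem_range (g : GL (Fin n) F) :
    heckeAlgebra.doubleCosetOperator (k := ℂ) (glInt n F) g ∈ (satakeInv n hϖ).range := by
  obtain ⟨N, hN⟩ := exists_zpowDiagGL_mul_isIntegralMatrix hϖ g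
  rw [← heckeDiag_self_pow_eq_zpowDiagGL hϖ] at hN
  set z := heckeDiag n (Units.mk0 ϖ hϖ.ne_zero) n with hzdef
  have hz : ∀ x : GL (Fin n) F, x * (z⁻¹ ^ N) = (z⁻¹ ^ N) * x := fun x =>
    (((Commute.inv_right (show Commute x z from mul_heckeDiag_self_comm _ x))).pow_right N).eq
  have hg : g = z⁻¹ ^ N * (z ^ N * g) := by rw [← mul_assoc, inv_pow, inv_mul_cancel, one_mul]
  rw [hg, ← heckeAlgebra.doubleCosetOperator_central_mul _ hz, doubleCosetOperator_heckeDiag_inv_pow hϖ]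
  exact Subalgebra.mul_mem _ (Subalgebra.pow_mem _ (doubleCosetOperator_heckeDiag_inv_mem_range hϖ) N)
    (doubleCosetOperator_mem_range_of_isIntegralMatrix hϖ hN)

/-- **`θ` is surjective**: the `T_g` span `ℋ(G, K)` and lie in the image. [folklore] -/
theorem satakeInv_surjective : Function.Surjective (satakeInv n hϖ) := by
  intro T
  have hle : Submodule.span ℂ (Set.range (heckeAlgebra.doubleCosetOperator (k := ℂ) (glInt n F))) ≤
      Subalgebra.toSubmodule (satakeInv n hϖ).range := by
    rw [Submodule.span_le]
    rintro _ ⟨g, rfl⟩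
    exact doubleCosetOperator_mem_range hϖ g
  have h : T ∈ (satakeInv n hϖ).range :=
    hle (heckeAlgebra.mem_span_range_doubleCosetOperator (glInt n F) T)
  exact (AlgHom.mem_range _).1 h

variable (n) in
/-- **The Satake isomorphism** `ℂ[e_1, …, e_n][e_n⁻¹] ≃ₐ[ℂ] ℋ(GL_n(F), GL_n(𝒪))`,
`e_r ↦ q^{r(r-1)/2} T_r`, for a field `F` whose valuation ring is a discrete valuation ring with
finite residue field and whose spherical Hecke algebra is commutative (e.g. a non-archimedean
local field). [folklore] -/
def satakeAlgEquiv : symmLaurent n ≃ₐ[ℂ] heckeAlgebra ℂ (GL (Fin n) F) (glInt n F) :=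
  AlgEquiv.ofBijective (satakeInv n hϖ) ⟨satakeInv_injective hϖ, satakeInv_surjective hϖ⟩

end Inverse

end SatakeGL

/-! ### The discharge -/

section LocalField

variable (n : ℕ) (F : Type u) [Field F] [ValuativeRel F] [TopologicalSpace F]
  [IsNonarchimedeanLocalField F]

/-- `(GL_n(𝒪), GL_n(F), GL_n(𝒪))` is a Hecke pair (compact open subgroup). [folklore] -/
instance isHeckeTriple_glInt :
    IsHeckeTriple (⊤ : Submonoid (GL (Fin n) F)) (glInt n F) (glInt n F) :=
  isHeckeTriple_top_of_isCompact_isOpen _ (isCompact_glInt n F) (isOpen_glInt n F)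

/-- The spherical Hecke algebra of `GL_n` over a local field is commutative
(`SatakeParametersGL.isGelfandPair_glInt_holds`), as an `IsMulCommutative` instance. [folklore] -/
instance isMulCommutative_heckeAlgebra_glInt :
    IsMulCommutative (heckeAlgebra ℂ (GL (Fin n) F) (glInt n F)) :=
  ⟨⟨SatakeParametersGL.isGelfandPair_glInt_holds n F⟩⟩

/-- **The Satake isomorphism for `GL_n`** (discharge of the named fact
`SatakeParametersGL.satake_gl`): for a non-archimedean local field `F`, the spherical Hecke algebra
`ℋ(GL_n(F), GL_n(𝒪_F)) = End_G(ℂ[G ⧸ K])` is isomorphic as a `ℂ`-algebra to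
`ℂ[e_1, …, e_n][e_n⁻¹] = ℂ[x_1^{±1}, …, x_n^{±1}]^{S_n}` (`symmLaurent n`), the operator
`q^{r(r-1)/2} T_r` corresponding to `e_r` (`SatakeGL.satakeAlgEquiv`): the inverse map `e_r ↦ q^{r(r-1)/2} T_r`
exists by commutativity (Gelfand) and the fundamental theorem of symmetric polynomials, is
injective because the Satake transform `𝒮` (`SatakeTransformGL`) inverts it onto
`ℂ[e][e_n⁻¹] ↪ ℂ[ℤⁿ]`, and surjective by the dimension count `dim A_m = dim P_m` over the
determinant grading together with the Cartan decomposition (Satake 1963; Tamagawa 1963; Cartier,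
Corvallis 1979, Thm. 4.1 and §IV.2, Example; Shimura (1971), Thm. 3.20–3.21; Macdonald (1995),
Ch. V, (3.4)–(3.5)). [cite: CartierCorvallis1979, Thm. 4.1] -/
theorem SatakeParametersGL.satake_gl_holds : SatakeParametersGL.satake_gl n F := by
  obtain ⟨ϖ, hϖ⟩ := exists_isUniformizingElement (F := F)
  exact ⟨(SatakeGL.satakeAlgEquiv n hϖ).symm⟩

end LocalField

end Literature.NumberTheory.Automorphic
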